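import Mathlib.Data.Real.Basic
import Mathlib.Tactic.Ring
import Mathlib.Tactic.Positivity
import Mathlib.Tactic.Linarith
import Mathlib.Tactic.FieldSimp
import Mathlib.Tactic.Push
import HarnessLib

/-!
# `Z(3,2)` at a three-port observer from the apex-pair row APL₁(3/10) — part 0: generic lemmas for the
# box certificates (deduction from a Handelman identity, box parametrisation)

Support file (prover seat `prim-ineq-gen-8`, gen 11; `--supports stmt-CriticalPhenomena-4575`, insurance line `Z(3,2)` =
`OneCutFive.ZeroOneThree`).  No definitions, no named facts, no sorries.  Memo:
`run/shared/lean/prim/prim-ineq-gen-8/FINDING-gen11-THREEPORT-APL.md`; certificates: ttrl lane `cp-lslp` / `cp-z32min`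
(`run/shared/lean/ttrl/sf3/Z32-3PORT-CERT.md` §4, `run/shared/lean/ttrl/sf3lean/`).

CONTEXT.  At a three-port observer `o` (hairs `α, β, γ ≤ 1/2` to `a, b, c`, graph off `o` arbitrary, five cells
`u0, uab, uac, ubc, u3` of the three-point law of `(a,b,c)` off `o`), the margins of the three pocket exchanges are
`M_a = u0·[(1−α)βγ − α(1−β)(1−γ)] + ubc·[(1−α)(β+γ−βγ) − α(1−β)(1−γ)]`-type bilinear forms (`ThreePort.margin_eq`), and the
statement `max(M_a, M_b, M_c) ≥ 0` under `Σ_v μ(o↔v) ≥ 2`, Gladkov's decision-tree rows `DT_{a,b,c} ≥ 0` and the apex-pair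
rows `APL₁(3/10)_{a,b,c} ≥ 0` is a polynomial inequality on `(simplex) × [0,1/2]³`, certified box by box (35 port boxes up
to the `S₃` symmetry; 16 vacuous, 19 with exact Handelman-type identities `Σ_v λ_v·M_v = Σ c·row·monomial + Σ c'·monomial`).
This file holds the two generic lemmas every box file uses:
* `ThreePort.deduce` — from `0 ≤ λ_a M_a + λ_b M_b + λ_c M_c`, `λ_v ≥ 0`, `λ_a + λ_b + λ_c > 0` conclude `max_v M_v ≥ 0`;
* `ThreePort.exists_boxParam` — `lo ≤ x ≤ hi`, `lo < hi` ⟹ `x = lo + (hi − lo)·t` with `0 ≤ t`, `0 ≤ 1 − t`.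
-/

namespace Summit.CriticalPhenomena.PercolationContinuityZ3.Theorems

namespace ThreePort

/-- **Deduction from a multiplier identity.**  If `λ_a M_a + λ_b M_b + λ_c M_c ≥ 0` with `λ_v ≥ 0` and
`λ_a + λ_b + λ_c > 0`, then some `M_v ≥ 0`. [this work] -/
theorem deduce {La Lb Lc Ma Mb Mc : ℝ} (h : 0 ≤ La * Ma + Lb * Mb + Lc * Mc) (ha : 0 ≤ La) (hb : 0 ≤ Lb)
    (hc : 0 ≤ Lc) (hpos : 0 < La + Lb + Lc) : 0 ≤ Ma ∨ 0 ≤ Mb ∨ 0 ≤ Mc := by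
  by_contra hcon
  push Not at hcon
  obtain ⟨hMa, hMb, hMc⟩ := hcon
  set m : ℝ := max Ma (max Mb Mc) with hm
  have hm0 : m < 0 := max_lt hMa (max_lt hMb hMc)
  have h1 : La * Ma ≤ La * m := mul_le_mul_of_nonneg_left (le_max_left _ _) ha
  have h2 : Lb * Mb ≤ Lb * m :=
    mul_le_mul_of_nonneg_left ((le_max_left _ _).trans (le_max_right _ _)) hb
  have h3 : Lc * Mc ≤ Lc * m :=
    mul_le_mul_of_nonneg_left ((le_max_right _ _).trans (le_max_right _ _)) hc
  have h4 : (La + Lb + Lc) * m < 0 := mul_neg_of_pos_of_neg hpos hm0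
  nlinarith

/-- **Local coordinate of a box.**  `lo ≤ x ≤ hi` with `lo < hi` gives `x = lo + (hi − lo)·t` for some
`t` with `0 ≤ t` and `0 ≤ 1 − t`. [folklore] -/
theorem exists_boxParam {lo hi x : ℝ} (hl : lo ≤ x) (hu : x ≤ hi) (hw : lo < hi) :
    ∃ t : ℝ, 0 ≤ t ∧ 0 ≤ 1 - t ∧ x = lo + (hi - lo) * t := by
  have hne : hi - lo ≠ 0 := by linarith
  refine ⟨(x - lo) / (hi - lo), div_nonneg (by linarith) (by linarith), ?_, ?_⟩
  · rw [sub_nonneg, div_le_one (by linarith)]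
    linarith
  · have e : (hi - lo) * ((x - lo) / (hi - lo)) = x - lo := by
      field_simp
    rw [e]
    ring

/-! ### Appended (gen 11): Gladkov's Lemma 1.2 in division form gives the polynomial row `DT`
used by `…ThreePortApl` to feed the tree theorem `gladkov2024_lemma_1_2_prodBernoulli` into `ThreePort.aplPoly`. -/

/-- From `q²/ib + q²/ic ≤ q + ia²` with `0 ≤ q ≤ ib, ic` (all nonnegative): `(q + ia²)·ib·ic − q²·(ib + ic) ≥ 0`. [this work] -/
theorem dt_poly_of_div {q ia ib ic : ℝ} (hq : 0 ≤ q) (hib : q ≤ ib) (hic : q ≤ ic)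
    (h : q ^ 2 / ib + q ^ 2 / ic ≤ q + ia ^ 2) : 0 ≤ (q + ia * ia) * (ib * ic) - q * q * (ib + ic) := by
  rcases eq_or_lt_of_le (hq.trans hib) with hb0 | hb0
  · have hq0 : q = 0 := le_antisymm (hb0 ▸ hib) hq
    rw [← hb0, hq0]; nlinarith [sq_nonneg ia]
  rcases eq_or_lt_of_le (hq.trans hic) with hc0 | hc0
  · have hq0 : q = 0 := le_antisymm (hc0 ▸ hic) hq
    rw [← hc0, hq0]; nlinarith [sq_nonneg ia]
  have e : (q ^ 2 / ib + q ^ 2 / ic) * (ib * ic) = q * q * (ib + ic) := by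
    field_simp
    ring
  have h2 : (q ^ 2 / ib + q ^ 2 / ic) * (ib * ic) ≤ (q + ia ^ 2) * (ib * ic) :=
    mul_le_mul_of_nonneg_right h (mul_nonneg hb0.le hc0.le)
  rw [e] at h2
  nlinarith [h2]

end ThreePort

end Summit.CriticalPhenomena.PercolationContinuityZ3.Theorems
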